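import Summits.QuantumFields.YangMills.Theorems.BalabanUVNodesN15KingModelExactCorrelationLength

/-!
# BalabanUVNodes ∕ N15 — THE KING-MODEL RUNG (PART Ϸ-m): THE ONE-STEP TRANSFER CONTRACTION ON THE AXES `S₂^{ℝ}((t+1)e_ν) ≤ e^{−m}S₂^{ℝ}(te_ν)` (`t ≥ 1`), STRICT
# MONOTONICITY, AND THE AXIAL DECAY AT THE RATE `m` ITSELF: `0 < S₂^{ℝ}(te_ν) ≤ S₂^{ℝ}(e_ν)e^{m}·e^{−mt}` (Track A, DAG node N15 = NE2; FAN-OUT v1.1 §N15 s3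
# «KING-MODEL RUNG»; part Ϸ-c's «every `c < m`» becomes `c = m` on the axes; count-neutral)

HONEST FRAMING.  Count-neutral (cell `pub-ymgap`, seat `pub-ymgap-dag-n15-e` g34; `--supports stmt-QuantumFields-27366 --as helper` = K3⁸
`SpineGivenEndpointR13SepCoPHV`).  King's `A = 0`, `g = 0` model ([King1986] C. King, Commun. Math. Phys. **102** (1986) 649–677; `S₂^{ℝ}` = the infinite-volume
two-point function of the unit-block averages of the continuum free field of mass `m = √m²`, (4.5) p.670, (4.36) p.674, Thm 3.3 (3.6) p.655).  Part Ϸ-j's Laplace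
representation on the axis, `S₂^{ℝ}(te_ν) = (2π)^{−(d+1)}∫W(q)e^{−M_q|t|}dq` with `W ≥ 0` and `M_q = √(|q|²+m²) ≥ m`, is a superposition of decaying exponentials
with rates `≥ m`; hence the transfer-matrix-type ONE-STEP CONTRACTION `S₂^{ℝ}((t+1)e_ν) ≤ e^{−m}·S₂^{ℝ}(te_ν)` (`t ≥ 1`), strict decrease in `t`, and by induction
`S₂^{ℝ}(te_ν) ≤ e^{−m(t−1)}S₂^{ℝ}(e_ν)`: on the lattice axes the free block field clusters at the rate `m` ITSELF (part Ϸ-c∕e gave every `c < m` in every direction;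
part Ϸ-j gave `lim|S₂^{ℝ}(te_ν)|^{1∕t} = e^{−m}`).  NOT a node discharge (N15 is booked through n15-a's knit, untouched here); nothing Bałaban ∕ continuum-Yang–Mills ∕
`ℝ⁴` ∕ OS ∕ Clay.  0 `sorry`, 0 def; standard axioms.

WHAT THIS FILE PROVES (kernel).  `one_le_abs_natCast`, `axisWeight_succ_le` (pointwise `W_{t+1} ≤ e^{−m}W_t`), ★★★ **`kingS2Inf_single_succ_le`** (the one-step contraction),
★★ `kingS2Inf_single_succ_lt` (strict decrease), ★★ `kingS2Inf_single_le_exp_mul` (`S₂^{ℝ}(te_ν) ≤ e^{−m(t−1)}S₂^{ℝ}(e_ν)`), ★★★ **`kingS2Inf_single_pos_le_exp`**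
(`0 < S₂^{ℝ}(te_ν) ≤ S₂^{ℝ}(e_ν)e^{m}·e^{−mt}`, `t ≥ 1`).

HONEST SCOPE.  King's free model, `K = ∞`, infinite volume, lattice axes, integer `t ≥ 1`.  N15 untouched; counts unmoved.  Locators (use): [King1986] (4.5) p.670,
(4.36) p.674, Thm 3.3 (3.6) p.655, Thm 2.1 (2.22) p.654.
-/

noncomputable section

open scoped BigOperators Topology
open Filter MeasureTheory Set

namespace Summit.QuantumFields.YangMills.BalabanUVNodes.N15KingModelRung.OptimalDecay

variable {d : ℕ}

/-- `1 ≤ |((t : ℤ) : ℝ)|` for a natural number `t ≥ 1`. [folklore] -/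
theorem one_le_abs_natCast {t : ℕ} (ht : 1 ≤ t) : 1 ≤ |(((t : ℕ) : ℤ) : ℝ)| := by
  rw [Int.cast_natCast, abs_of_nonneg (Nat.cast_nonneg t)]
  exact_mod_cast ht

/-- Pointwise: `W(q)e^{−M_q(t+1)} ≤ e^{−m}·W(q)e^{−M_q t}` (`M_q ≥ m = √m²`, `W ≥ 0`, `t ≥ 0`). [folklore] -/
theorem axisWeight_succ_le {m2 : ℝ} (hm : 0 < m2) (t : ℕ) (q : Fin d → ℝ) :
    (∏ j, Real.sinc (q j / 2) ^ 2) * (2 * Real.pi * (Real.cosh (Real.sqrt ((∑ j, q j ^ 2) + m2)) - 1) / Real.sqrt ((∑ j, q j ^ 2) + m2) ^ 3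
        * Real.exp (-(Real.sqrt ((∑ j, q j ^ 2) + m2) * |((((t + 1 : ℕ)) : ℤ) : ℝ)|)))
      ≤ Real.exp (-Real.sqrt m2) * ((∏ j, Real.sinc (q j / 2) ^ 2) * (2 * Real.pi * (Real.cosh (Real.sqrt ((∑ j, q j ^ 2) + m2)) - 1) / Real.sqrt ((∑ j, q j ^ 2) + m2) ^ 3
        * Real.exp (-(Real.sqrt ((∑ j, q j ^ 2) + m2) * |(((t : ℕ) : ℤ) : ℝ)|)))) := by
  set M := Real.sqrt ((∑ j, q j ^ 2) + m2) with hMdef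
  have hmM : Real.sqrt m2 ≤ M := Real.sqrt_le_sqrt (le_add_of_nonneg_left (Finset.sum_nonneg fun j _ => sq_nonneg _))
  have hP : 0 ≤ ∏ j, Real.sinc (q j / 2) ^ 2 := Finset.prod_nonneg fun j _ => sq_nonneg _
  have hc : 0 ≤ Real.cosh M - 1 := by linarith [Real.one_le_cosh M]
  have hw : 0 ≤ 2 * Real.pi * (Real.cosh M - 1) / M ^ 3 := by positivity
  have h1 : |((((t + 1 : ℕ)) : ℤ) : ℝ)| = (t : ℝ) + 1 := by push_cast; exact abs_of_nonneg (by positivity)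
  have h0 : |(((t : ℕ) : ℤ) : ℝ)| = (t : ℝ) := by push_cast; exact abs_of_nonneg (by positivity)
  rw [h1, h0]
  have he : Real.exp (-(M * ((t : ℝ) + 1))) ≤ Real.exp (-Real.sqrt m2) * Real.exp (-(M * t)) := by
    rw [← Real.exp_add]
    exact Real.exp_le_exp.mpr (by nlinarith)
  calc _ = (∏ j, Real.sinc (q j / 2) ^ 2) * (2 * Real.pi * (Real.cosh M - 1) / M ^ 3) * Real.exp (-(M * ((t : ℝ) + 1))) := by ring
    _ ≤ (∏ j, Real.sinc (q j / 2) ^ 2) * (2 * Real.pi * (Real.cosh M - 1) / M ^ 3) * (Real.exp (-Real.sqrt m2) * Real.exp (-(M * t))) :=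
        mul_le_mul_of_nonneg_left he (mul_nonneg hP hw)
    _ = _ := by ring

/-- ★★★ **THE ONE-STEP TRANSFER CONTRACTION**: for `t ≥ 1`, `S₂^{ℝ}((t+1)e_ν) ≤ e^{−√m²}·S₂^{ℝ}(te_ν)`. [cite: King1986, (4.5) p.670, Thm 3.3 (3.6) p.655] -/
theorem kingS2Inf_single_succ_le {m2 : ℝ} (hm : 0 < m2) (ν : Fin (d + 1)) {t : ℕ} (ht : 1 ≤ t) :
    kingS2Inf m2 (Pi.single ν (((t + 1 : ℕ)) : ℤ)) ≤ Real.exp (-Real.sqrt m2) * kingS2Inf m2 (Pi.single ν ((t : ℕ) : ℤ)) := by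
  have ht1 := one_le_abs_natCast ht
  have ht2 := one_le_abs_natCast (Nat.le_succ_of_le ht)
  rw [kingS2Inf_single_eq hm ν ht2, kingS2Inf_single_eq hm ν ht1]
  have hmono := integral_mono (integrable_axisWeight (d := d) hm ht2) ((integrable_axisWeight (d := d) hm ht1).const_mul (Real.exp (-Real.sqrt m2)))
    fun q => axisWeight_succ_le hm t q
  rw [integral_const_mul] at hmono
  have hK : 0 ≤ ((2 * Real.pi) ^ (d + 1))⁻¹ := by positivity
  refine (mul_le_mul_of_nonneg_left hmono hK).trans (le_of_eq ?_)
  ring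

/-- ★★ **Strict monotonicity on the axes**: `S₂^{ℝ}((t+1)e_ν) < S₂^{ℝ}(te_ν)` for `t ≥ 1` (`e^{−m} < 1` and part Ϸ-j's `S₂^{ℝ}(te_ν) > 0`).
[cite: King1986, (4.5) p.670, Thm 3.3 (3.6) p.655] -/
theorem kingS2Inf_single_succ_lt {m2 : ℝ} (hm : 0 < m2) (ν : Fin (d + 1)) {t : ℕ} (ht : 1 ≤ t) :
    kingS2Inf m2 (Pi.single ν (((t + 1 : ℕ)) : ℤ)) < kingS2Inf m2 (Pi.single ν ((t : ℕ) : ℤ)) := by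
  have hpos := kingS2Inf_single_pos hm ν (one_le_abs_natCast ht)
  have he : Real.exp (-Real.sqrt m2) < 1 := by
    rw [← Real.exp_zero]
    exact Real.exp_lt_exp.mpr (by linarith [Real.sqrt_pos.mpr hm])
  calc _ ≤ Real.exp (-Real.sqrt m2) * kingS2Inf m2 (Pi.single ν ((t : ℕ) : ℤ)) := kingS2Inf_single_succ_le hm ν ht
    _ < 1 * kingS2Inf m2 (Pi.single ν ((t : ℕ) : ℤ)) := mul_lt_mul_of_pos_right he hpos
    _ = _ := one_mul _

/-- ★★ **Iterated**: `S₂^{ℝ}(te_ν) ≤ e^{−√m²(t−1)}·S₂^{ℝ}(e_ν)` for every `t ≥ 1`. [cite: King1986, Thm 3.3 (3.6) p.655] -/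
theorem kingS2Inf_single_le_exp_mul {m2 : ℝ} (hm : 0 < m2) (ν : Fin (d + 1)) {t : ℕ} (ht : 1 ≤ t) :
    kingS2Inf m2 (Pi.single ν ((t : ℕ) : ℤ)) ≤ Real.exp (-(Real.sqrt m2 * ((t : ℝ) - 1))) * kingS2Inf m2 (Pi.single ν ((1 : ℕ) : ℤ)) := by
  induction t, ht using Nat.le_induction with
  | base => simp
  | succ n hn ih =>
      calc kingS2Inf m2 (Pi.single ν (((n + 1 : ℕ)) : ℤ)) ≤ Real.exp (-Real.sqrt m2) * kingS2Inf m2 (Pi.single ν ((n : ℕ) : ℤ)) :=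
            kingS2Inf_single_succ_le hm ν hn
        _ ≤ Real.exp (-Real.sqrt m2) * (Real.exp (-(Real.sqrt m2 * ((n : ℝ) - 1))) * kingS2Inf m2 (Pi.single ν ((1 : ℕ) : ℤ))) :=
            mul_le_mul_of_nonneg_left ih (Real.exp_pos _).le
        _ = Real.exp (-(Real.sqrt m2 * (((n + 1 : ℕ) : ℝ) - 1))) * kingS2Inf m2 (Pi.single ν ((1 : ℕ) : ℤ)) := by
            rw [← mul_assoc, ← Real.exp_add]
            congr 2
            push_cast
            ring

/-- ★★★ **THE AXIAL DECAY AT THE RATE `m` ITSELF**: for every `t ≥ 1` and every direction `ν`,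
`0 < S₂^{ℝ}(te_ν) ≤ (S₂^{ℝ}(e_ν)e^{√m²})·e^{−√m²·t}` — on the lattice axes part Ϸ-c's «every rate `c < m`» holds with `c = m`. [cite: King1986, Thm 3.3 (3.6) p.655,
Thm 2.1 (2.22) p.654] -/
theorem kingS2Inf_single_pos_le_exp {m2 : ℝ} (hm : 0 < m2) (ν : Fin (d + 1)) {t : ℕ} (ht : 1 ≤ t) :
    0 < kingS2Inf m2 (Pi.single ν ((t : ℕ) : ℤ))
      ∧ kingS2Inf m2 (Pi.single ν ((t : ℕ) : ℤ)) ≤ (kingS2Inf m2 (Pi.single ν ((1 : ℕ) : ℤ)) * Real.exp (Real.sqrt m2)) * Real.exp (-(Real.sqrt m2 * t)) := by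
  refine ⟨kingS2Inf_single_pos hm ν (one_le_abs_natCast ht), (kingS2Inf_single_le_exp_mul hm ν ht).trans (le_of_eq ?_)⟩
  rw [mul_comm, mul_assoc, ← Real.exp_add]
  congr 2
  ring

end Summit.QuantumFields.YangMills.BalabanUVNodes.N15KingModelRung.OptimalDecay
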